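import Literature.NumberTheory.GaloisRepresentations.CubicEisensteinRamificationBreakProofs
import Literature.NumberTheory.GaloisRepresentations.RamificationFiltrationHerbrandInverseProofs
import HarnessLib

/-!
# Ramification of a quadratic extension generated by an Eisenstein quadratic; the upper
# numbering of a filtration with a single break (Serre, *Local Fields*, Ch. IV §§1, 3)

`Proofs` file (theorems only, no definitions, no named facts) in topic
`NumberTheory/GaloisRepresentations`, companion of `CubicEisensteinRamification*Proofs` (same
setting and notation), landed by the seat of bsd.S15
(`Literature.NumberTheory.EllipticCurves.conductorNorm_eq_artinConductorNat`) as the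
Galois-theoretic input of Ogg's formula at the *potentially multiplicative* places of residue
characteristic `2` of an elliptic curve over `ℚ`: there the wild conductor is twice the
ramification break of the quadratic field `ℚ(√d)` trivialising the twist (Silverman, *ATAEC*,
proof of Thm. IV.10.2(b), case `v(j) < 0`, PDF pp. 359–360, read in residue characteristic `2`).

* `upperRamificationSubgroup_eq_bot_iff_of_break`, `setOf_upperRamificationSubgroup_ne_bot_eq_Ioc`
  — **one break in the upper numbering**: for a finite group `G` whose lower filtration at `𝔓`
  is `G_i = G_0 ≠ 1` for `i ≤ b` and `G_{b+1} = 1`, the Herbrand function is the identity on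
  `[0, b]`, so `G^u = 1 ↔ u > b` for `u > 0`, and `{u > 0 : G^u ≠ 1} = (0, b]` (volume `b`);
* **quadratic Eisenstein extensions** (`R` Dedekind with fraction field `K`, `L/K` Galois with
  `#Gal(L/K) = 2`, `S = integralClosure R L`, `𝔓 ≠ 0` maximal in `S`, `θ ∈ S` with
  `θ² + c₁θ + c₀ = 0`, `c₁ ∈ 𝔭 = 𝔓 ∩ R`, `c₀ ∈ 𝔭 ∖ 𝔭²`, moved by the non-trivial
  automorphism): `two_mul_ord_root_eq` (`2v_𝔓(θ) = e`), `card_inertia_eq_two` (`e = 2 = #G₀`,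
  `v_𝔓(θ) = 1`: `𝔓` is totally ramified and `θ` is a uniformizer), `smul_root_eq` (`σθ = -θ - c₁`
  for `σ ≠ 1`), and `mem_ramificationSubgroup_iff_of_quadratic` — **`σ ∈ G_i ↔ 𝔓ⁱ⁺¹ ∣ 2θ + c₁`**
  (`i_G(σ) = v_𝔓(σθ - θ) = v_𝔓(2θ + c₁)`), whence `ramificationSubgroup_eq_top_iff_of_quadratic`:
  with `v_𝔓(2θ + c₁) = b + 1`, `G_i = G ↔ i ≤ b` and `G_i = 1 ↔ b < i`;
* `ord_two_mul_root_add_eq` — `v_𝔓(2θ + c₁) = min (2v_𝔭(2) + 1, 2v_𝔭(c₁))` (the two orders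
  have different parity); over `ℤ₍₂₎`: `b = 2` for `X² - d` (`2 ∥ d`) and `b = 1` for
  `X² - 2X + 1 - d` (`d ≡ 3 mod 4`), i.e. the conductor exponents `3` and `2` of `ℚ₂(√d)`.

## References

* J.-P. Serre, *Local Fields*, GTM 67 (1979): Ch. I §6 Prop. 17–18 (Eisenstein polynomials),
  §7 Cor. to Prop. 21 (`e = #G₀`); Ch. IV §1 Lemma 1, Prop. 2 (`i_G`), §3 (Herbrand `φ, ψ`,
  upper numbering; example of a cyclic extension of prime degree). [SerreLocalFields1979]
* J. H. Silverman, *Advanced Topics in the Arithmetic of Elliptic Curves*, GTM 151 (1994),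
  Thm. IV.10.2(b) and its proof, case `v(j) < 0` (PDF pp. 358–360). [SilvermanATAEC1994]
-/

noncomputable section

open scoped Pointwise

namespace Literature.NumberTheory.GaloisRepresentations

/-! ### One break: the upper numbering of a filtration `G_0 = ⋯ = G_b ⊋ G_{b+1} = 1` -/

section OneBreak

variable {S : Type*} [CommRing S] (𝔓 : Ideal S) (G : Type*) [Group G] [MulSemiringAction G S]
  [Finite G]

/-- If `G_i = G_0` for all `i ≤ b` then the Herbrand function is the identity on `[0, b]`
(its integrand `#G_{⌈t⌉}/#G_0` is `1` there).  Serre, *Local Fields*, Ch. IV §3.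
[cite: SerreLocalFields1979, Ch. IV §3 (definition of φ, p. 73)] -/
theorem herbrandPhi_eq_self_of_le {b : ℕ}
    (htop : ∀ i ≤ b, 𝔓.ramificationSubgroup G i = 𝔓.ramificationSubgroup G 0)
    {u : ℝ} (hu0 : 0 ≤ u) (hub : u ≤ b) : herbrandPhi 𝔓 G u = u := by
  have h : Set.EqOn (herbrandIntegrand 𝔓 G) (fun _ => (1 : ℝ)) (Set.uIcc 0 u) := by
    intro t ht
    rw [Set.uIcc_of_le hu0] at ht
    have hceil : ⌈t⌉₊ ≤ b := by
      have : ⌈t⌉₊ ≤ ⌈(b : ℝ)⌉₊ := Nat.ceil_le_ceil (ht.2.trans hub)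
      rwa [Nat.ceil_natCast] at this
    have hc : (Nat.card (𝔓.ramificationSubgroup G 0) : ℝ) ≠ 0 :=
      Nat.cast_ne_zero.mpr (Nat.card_pos (α := 𝔓.ramificationSubgroup G 0)).ne'
    simp only [herbrandIntegrand, htop _ hceil, div_self hc, inv_one]
  rw [herbrandPhi, intervalIntegral.integral_congr h, intervalIntegral.integral_const, smul_eq_mul,
    mul_one, sub_zero]

/-- … hence also `ψ = φ⁻¹` is the identity on `[0, b]`. Serre, *Local Fields*, Ch. IV §3.
[cite: SerreLocalFields1979, Ch. IV §3 (ψ = φ⁻¹, p. 73)] -/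
theorem herbrandPsi_eq_self_of_le {b : ℕ}
    (htop : ∀ i ≤ b, 𝔓.ramificationSubgroup G i = 𝔓.ramificationSubgroup G 0)
    {u : ℝ} (hu0 : 0 ≤ u) (hub : u ≤ b) : herbrandPsi 𝔓 G u = u := by
  conv_lhs => rw [← herbrandPhi_eq_self_of_le 𝔓 G htop hu0 hub]
  exact herbrandPsi_herbrandPhi_holds 𝔓 G u

/-- **One break in the upper numbering.**  If the lower filtration of `𝔓` is
`G_i = G_0 ≠ 1` for `i ≤ b` and `G_{b+1} = 1`, then for `u > 0`: `G^u = 1 ↔ b < u`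
(`G^u = G_{⌈ψ u⌉}`, `ψ = id` on `[0, b]`, `ψ` strictly increasing).  For `G` of prime order
this is Serre's example: the unique break is the same in both numberings.
Serre, *Local Fields*, Ch. IV §3. [cite: SerreLocalFields1979, Ch. IV §3 Prop. 14 ff. (upper numbering)] -/
theorem upperRamificationSubgroup_eq_bot_iff_of_break {b : ℕ}
    (htop : ∀ i ≤ b, 𝔓.ramificationSubgroup G i = 𝔓.ramificationSubgroup G 0)
    (hbot : 𝔓.ramificationSubgroup G (b + 1) = ⊥) (hne : 𝔓.ramificationSubgroup G 0 ≠ ⊥)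
    {u : ℝ} (hu : 0 < u) :
    upperRamificationSubgroup 𝔓 G u = ⊥ ↔ (b : ℝ) < u := by
  constructor
  · intro h
    by_contra hle
    push Not at hle
    rw [upperRamificationSubgroup, herbrandPsi_eq_self_of_le 𝔓 G htop hu.le hle] at h
    have hceil : ⌈u⌉₊ ≤ b := by
      have : ⌈u⌉₊ ≤ ⌈(b : ℝ)⌉₊ := Nat.ceil_le_ceil hle
      rwa [Nat.ceil_natCast] at this
    rw [htop _ hceil] at h
    exact hne h
  · intro h
    rw [upperRamificationSubgroup, eq_bot_iff, ← hbot]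
    refine 𝔓.ramificationSubgroup_antitone G ?_
    have hψb : herbrandPsi 𝔓 G b = b := herbrandPsi_eq_self_of_le 𝔓 G htop (Nat.cast_nonneg b) le_rfl
    have hlt : (b : ℝ) < herbrandPsi 𝔓 G u := by
      rw [← hψb]; exact herbrandPsi_strictMono 𝔓 G h
    exact Nat.lt_ceil.mpr hlt

/-- **The set of `u > 0` with `G^u ≠ 1` is `(0, b]`** under the hypotheses of
`upperRamificationSubgroup_eq_bot_iff_of_break`; in particular it has Lebesgue measure `b`
(`volume_real_setOf_upperRamificationSubgroup_ne_bot`).  Serre, *Local Fields*, Ch. IV §3.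
[cite: SerreLocalFields1979, Ch. IV §3 (upper numbering)] -/
theorem setOf_upperRamificationSubgroup_ne_bot_eq_Ioc {b : ℕ}
    (htop : ∀ i ≤ b, 𝔓.ramificationSubgroup G i = 𝔓.ramificationSubgroup G 0)
    (hbot : 𝔓.ramificationSubgroup G (b + 1) = ⊥) (hne : 𝔓.ramificationSubgroup G 0 ≠ ⊥) :
    {u : ℝ | 0 < u ∧ upperRamificationSubgroup 𝔓 G u ≠ ⊥} = Set.Ioc (0 : ℝ) b := by
  ext u
  simp only [Set.mem_setOf_eq, Set.mem_Ioc]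
  constructor
  · rintro ⟨hu, hne'⟩
    refine ⟨hu, ?_⟩
    by_contra hlt
    push Not at hlt
    exact hne' ((upperRamificationSubgroup_eq_bot_iff_of_break 𝔓 G htop hbot hne hu).mpr hlt)
  · rintro ⟨hu, hub⟩
    exact ⟨hu, fun h => absurd ((upperRamificationSubgroup_eq_bot_iff_of_break 𝔓 G htop hbot hne
      hu).mp h) (not_lt.mpr hub)⟩

/-- The Lebesgue measure of `{u > 0 : G^u ≠ 1}` is `b`. [cite: SerreLocalFields1979, Ch. IV §3 (upper numbering)] -/
theorem volume_real_setOf_upperRamificationSubgroup_ne_bot {b : ℕ}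
    (htop : ∀ i ≤ b, 𝔓.ramificationSubgroup G i = 𝔓.ramificationSubgroup G 0)
    (hbot : 𝔓.ramificationSubgroup G (b + 1) = ⊥) (hne : 𝔓.ramificationSubgroup G 0 ≠ ⊥) :
    MeasureTheory.volume.real {u : ℝ | 0 < u ∧ upperRamificationSubgroup 𝔓 G u ≠ ⊥} = b := by
  rw [setOf_upperRamificationSubgroup_ne_bot_eq_Ioc 𝔓 G htop hbot hne, Real.volume_real_Ioc_of_le
    (Nat.cast_nonneg b), sub_zero]

end OneBreak

/-! ### Quadratic Eisenstein extensions -/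

section Quadratic

variable (R : Type*) {K L : Type*} [CommRing R] [IsDedekindDomain R] [Field K] [Field L]
  [Algebra R K] [IsFractionRing R K] [Algebra R L] [Algebra K L] [IsScalarTower R K L]
  [FiniteDimensional K L] [IsGalois K L]
  (𝔓 : Ideal (integralClosure R L)) [𝔓.IsMaximal]

variable {R}

omit [IsDedekindDomain R] [IsFractionRing R K] [FiniteDimensional K L] [IsGalois K L] in
/-- A root of `X² + c₁X + c₀` with `c₁, c₀ ∈ 𝔭 = 𝔓 ∩ R` lies in `𝔓`. [folklore] -/
theorem root_mem_of_coeff_mem_quadratic {θ : integralClosure R L} {c₁ c₀ : R}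
    (hθ : θ ^ 2 + algebraMap R _ c₁ * θ + algebraMap R _ c₀ = 0)
    (hc₁ : c₁ ∈ 𝔓.under R) (hc₀ : c₀ ∈ 𝔓.under R) : θ ∈ 𝔓 := by
  have h2 : θ ^ 2 ∈ 𝔓 := by
    have : θ ^ 2 = -(algebraMap R _ c₁ * θ + algebraMap R _ c₀) := by linear_combination hθ
    rw [this]
    refine Submodule.neg_mem _ (Ideal.add_mem _ ?_ ?_)
    · exact Ideal.mul_mem_right _ _ (Ideal.mem_comap.mp hc₁)
    · exact Ideal.mem_comap.mp hc₀
  exact Ideal.IsPrime.mem_of_pow_mem inferInstance 2 h2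

omit [IsGalois K L] in
include K in
/-- **A root of an Eisenstein quadratic has `v_𝔓(θ) = e/2`**: if `θ² + c₁θ + c₀ = 0` with
`c₁, c₀ ∈ 𝔭 = 𝔓 ∩ R` and `v_𝔭(c₀) = 1`, then `2 v_𝔓(θ) = e(𝔓|𝔭)` (the term `c₀` dominates
`c₁θ`, so `v(θ²) = v(c₀) = e`).  Serre, *Local Fields*, Ch. I §6.
[cite: SerreLocalFields1979, Ch. I §6 Prop. 17–18] -/
theorem two_mul_ord_root_eq [Algebra.IsSeparable K L] (h𝔓 : 𝔓 ≠ ⊥) {θ : integralClosure R L}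
    {c₁ c₀ : R} (hθ : θ ^ 2 + algebraMap R _ c₁ * θ + algebraMap R _ c₀ = 0)
    (hc₁ : c₁ ∈ 𝔓.under R) (hc₀ : c₀ ∈ 𝔓.under R) (hc₀' : c₀ ∉ (𝔓.under R) ^ 2) :
    2 * ord 𝔓 θ = (𝔓.under R).ramificationIdx' 𝔓 := by
  haveI : IsDedekindDomain (integralClosure R L) := integralClosure.isDedekindDomain R K L
  set e := (𝔓.under R).ramificationIdx' 𝔓 with he
  set C₁ := algebraMap R (integralClosure R L) c₁
  set C₀ := algebraMap R (integralClosure R L) c₀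
  have hord₀ : ord 𝔓 C₀ = e := by
    rw [ord_algebraMap (K := K) 𝔓 h𝔓, ord_eq_one _ hc₀ hc₀', mul_one]
  have hle₁ : (e : ℕ∞) ≤ ord 𝔓 C₁ := by
    rw [ord_algebraMap (K := K) 𝔓 h𝔓]
    have h1 : (1 : ℕ∞) ≤ ord (𝔓.under R) c₁ := by
      rw [show (1 : ℕ∞) = ((1 : ℕ) : ℕ∞) from rfl, ← mem_pow_iff_le_ord, pow_one]
      exact hc₁
    calc (e : ℕ∞) = e * 1 := (mul_one _).symm
      _ ≤ e * ord (𝔓.under R) c₁ := by gcongr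
  -- `θ ≠ 0`, `v(θ) = m ≥ 1`
  have hθ0 : θ ≠ 0 := by
    rintro rfl
    apply hc₀'
    have hC0 : C₀ = 0 := by simpa using hθ
    have hc00 : c₀ = 0 := by
      haveI := faithfulSMul_integralClosure R (K := K) (L := L)
      exact (FaithfulSMul.algebraMap_injective R (integralClosure R L)) (by rw [map_zero]; exact hC0)
    rw [hc00]
    exact zero_mem _
  obtain ⟨m, hm⟩ := exists_ord_eq_natCast 𝔓 h𝔓 hθ0
  have hm1 : 1 ≤ m := by
    have hθP : θ ∈ 𝔓 := root_mem_of_coeff_mem_quadratic 𝔓 hθ hc₁ hc₀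
    have := (mem_pow_iff_le_ord 𝔓 (n := 1)).mp (by rwa [pow_one])
    rw [hm] at this
    exact_mod_cast this
  have h2 : ord 𝔓 (θ ^ 2) = (2 * m : ℕ) := by rw [ord_pow 𝔓 h𝔓, hm]; norm_cast
  have hrest : ((e + m : ℕ) : ℕ∞) ≤ ord 𝔓 (C₁ * θ) := by
    rw [ord_mul 𝔓 h𝔓, hm]
    calc ((e + m : ℕ) : ℕ∞) = (e : ℕ∞) + (m : ℕ∞) := by norm_cast
      _ ≤ ord 𝔓 C₁ + (m : ℕ∞) := by gcongr
  have hrel : θ ^ 2 + C₁ * θ = -C₀ := by linear_combination hθ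
  have hordneg : ord 𝔓 (-C₀) = e := by rw [ord_neg, hord₀]
  rcases lt_trichotomy (2 * m) e with hlt | heq | hgt
  · exfalso
    have hdom : ord 𝔓 (θ ^ 2) < ord 𝔓 (C₁ * θ) := by
      rw [h2]
      refine lt_of_lt_of_le ?_ hrest
      exact_mod_cast (by omega : 2 * m < e + m)
    have := ord_add_eq_of_lt 𝔓 hdom
    rw [add_comm, hrel, hordneg, h2] at this
    exact absurd (by exact_mod_cast this : e = 2 * m) (by omega)
  · rw [hm]; exact_mod_cast heq
  · exfalso
    have hge : ((e + 1 : ℕ) : ℕ∞) ≤ ord 𝔓 (θ ^ 2 + C₁ * θ) := by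
      refine le_trans ?_ (min_ord_le_ord_add 𝔓 _ _)
      rw [le_min_iff, h2]
      exact ⟨by exact_mod_cast (by omega : e + 1 ≤ 2 * m),
        le_trans (by exact_mod_cast (by omega : e + 1 ≤ e + m)) hrest⟩
    rw [hrel, hordneg] at hge
    have : e + 1 ≤ e := by exact_mod_cast hge
    omega

include K in
/-- **`𝔓` is totally ramified in a quadratic Eisenstein extension**: if moreover `#Gal(L/K) = 2`
(and the residue extension at `𝔓` is separable), then `e(𝔓|𝔭) = 2 = #G₀`, `G₀ = Gal(L/K)` and
`v_𝔓(θ) = 1` — `θ` is a uniformizer at `𝔓`.  Serre, *Local Fields*, Ch. I §6 Prop. 17–18 and §7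
Cor. to Prop. 21. [cite: SerreLocalFields1979, Ch. I §6 Prop. 17–18, §7 Cor. to Prop. 21] -/
theorem card_inertia_eq_two [Algebra.IsSeparable (R ⧸ 𝔓.under R) (integralClosure R L ⧸ 𝔓)]
    (h𝔓 : 𝔓 ≠ ⊥) (hG : Nat.card (L ≃ₐ[K] L) = 2) {θ : integralClosure R L} {c₁ c₀ : R}
    (hθ : θ ^ 2 + algebraMap R _ c₁ * θ + algebraMap R _ c₀ = 0)
    (hc₁ : c₁ ∈ 𝔓.under R) (hc₀ : c₀ ∈ 𝔓.under R) (hc₀' : c₀ ∉ (𝔓.under R) ^ 2) :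
    (𝔓.under R).ramificationIdx' 𝔓 = 2 ∧ Nat.card (𝔓.inertia (L ≃ₐ[K] L)) = 2 ∧
      𝔓.inertia (L ≃ₐ[K] L) = ⊤ ∧ ord 𝔓 θ = 1 := by
  haveI : IsDedekindDomain (integralClosure R L) := integralClosure.isDedekindDomain R K L
  have h2m := two_mul_ord_root_eq (K := K) 𝔓 h𝔓 hθ hc₁ hc₀ hc₀'
  have he := ramificationIdx'_under_base_eq_card_inertia (K := K) 𝔓 h𝔓
  -- `v(θ) = m ≥ 1` finite
  have hθ0 : θ ≠ 0 := by
    rintro rfl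
    rw [ord_zero, ENat.mul_top (by norm_num)] at h2m
    exact absurd h2m.symm (ENat.coe_ne_top _)
  obtain ⟨m, hm⟩ := exists_ord_eq_natCast 𝔓 h𝔓 hθ0
  have hm1 : 1 ≤ m := by
    have hθP : θ ∈ 𝔓 := root_mem_of_coeff_mem_quadratic 𝔓 hθ hc₁ hc₀
    have := (mem_pow_iff_le_ord 𝔓 (n := 1)).mp (by rwa [pow_one])
    rw [hm] at this
    exact_mod_cast this
  rw [hm] at h2m
  have h2m' : 2 * m = (𝔓.under R).ramificationIdx' 𝔓 := by exact_mod_cast h2m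
  -- `#G₀ ≤ #G = 2`
  have hle : Nat.card (𝔓.inertia (L ≃ₐ[K] L)) ≤ 2 := by
    rw [← hG]; exact Subgroup.card_le_card_group _
  have hm1' : m = 1 := by omega
  have hcard : Nat.card (𝔓.inertia (L ≃ₐ[K] L)) = 2 := by omega
  refine ⟨by omega, hcard, ?_, by rw [hm, hm1']; rfl⟩
  exact Subgroup.eq_top_of_card_eq _ (by rw [hcard, hG])

omit [IsDedekindDomain R] [IsFractionRing R K] [FiniteDimensional K L] [IsGalois K L] [𝔓.IsMaximal] in
/-- **The conjugate root.**  For `θ² + c₁θ + c₀ = 0` over `R` and `g ∈ Gal(L/K)` with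
`gθ ≠ θ`: `gθ = -θ - c₁` (both are roots; `(gθ - θ)(gθ + θ + c₁) = 0` in the domain `S`).
[folklore] -/
theorem smul_root_eq {θ : integralClosure R L} {c₁ c₀ : R}
    (hθ : θ ^ 2 + algebraMap R _ c₁ * θ + algebraMap R _ c₀ = 0) {g : L ≃ₐ[K] L}
    (hg : g • θ ≠ θ) : g • θ = -θ - algebraMap R _ c₁ := by
  have hg' : (g • θ) ^ 2 + algebraMap R _ c₁ * (g • θ) + algebraMap R _ c₀ = 0 := by
    have h := congrArg (g • ·) hθ
    simp only [smul_add, smul_mul', smul_pow', smul_algebraMap, smul_zero] at h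
    exact h
  have hprod : (g • θ - θ) * (g • θ + θ + algebraMap R _ c₁) = 0 := by
    linear_combination hg' - hθ
  rcases mul_eq_zero.mp hprod with h | h
  · exact absurd (sub_eq_zero.mp h) hg
  · linear_combination h

include K in
/-- **`i_G(σ) = v_𝔓(2θ + c₁)`** for the non-trivial automorphism of a quadratic Eisenstein
extension: with `#Gal(L/K) = 2`, `θ² + c₁θ + c₀ = 0` Eisenstein at `𝔭`, and `σθ ≠ θ`, one has
`σ ∈ G₀` and, for every `i`, **`σ ∈ G_i ↔ 2θ + c₁ ∈ 𝔓ⁱ⁺¹`** — the uniformizer criterion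
(`mem_ramificationSubgroup_iff_of_mem_inertia`, Serre IV §1 Lemma 1) for the uniformizer `θ`,
with `σθ - θ = -(2θ + c₁)` (`smul_root_eq`).  Serre, *Local Fields*, Ch. IV §1.
[cite: SerreLocalFields1979, Ch. IV §1 Lemma 1 and Prop. 2] -/
theorem mem_ramificationSubgroup_iff_of_quadratic
    [Algebra.IsSeparable (R ⧸ 𝔓.under R) (integralClosure R L ⧸ 𝔓)]
    (h𝔓 : 𝔓 ≠ ⊥) (hG : Nat.card (L ≃ₐ[K] L) = 2) {θ : integralClosure R L} {c₁ c₀ : R}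
    (hθ : θ ^ 2 + algebraMap R _ c₁ * θ + algebraMap R _ c₀ = 0)
    (hc₁ : c₁ ∈ 𝔓.under R) (hc₀ : c₀ ∈ 𝔓.under R) (hc₀' : c₀ ∉ (𝔓.under R) ^ 2)
    {σ : L ≃ₐ[K] L} (hσ : σ • θ ≠ θ) (i : ℕ) :
    σ ∈ 𝔓.ramificationSubgroup (L ≃ₐ[K] L) i ↔ 2 * θ + algebraMap R _ c₁ ∈ 𝔓 ^ (i + 1) := by
  haveI : IsDedekindDomain (integralClosure R L) := integralClosure.isDedekindDomain R K L
  obtain ⟨-, -, htop, hord⟩ := card_inertia_eq_two (K := K) 𝔓 h𝔓 hG hθ hc₁ hc₀ hc₀'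
  have hσI : σ ∈ 𝔓.inertia (L ≃ₐ[K] L) := by rw [htop]; exact Subgroup.mem_top σ
  have hθ1 : θ ∈ 𝔓 := by
    have := (mem_pow_iff_le_ord 𝔓 (b := θ) (n := 1)).mpr (by rw [hord]; exact le_rfl)
    rwa [pow_one] at this
  have hθ2 : θ ∉ 𝔓 ^ 2 := by
    intro h
    have := (mem_pow_iff_le_ord 𝔓 (b := θ) (n := 2)).mp h
    rw [hord] at this
    exact absurd (by exact_mod_cast this : (2 : ℕ) ≤ 1) (by norm_num)
  rw [mem_ramificationSubgroup_iff_of_mem_inertia (K := K) 𝔓 h𝔓 hσI hθ1 hθ2 i, smul_root_eq hθ hσ,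
    show -θ - algebraMap R _ c₁ - θ = -(2 * θ + algebraMap R _ c₁) by ring, neg_mem_iff]

include K in
/-- **The lower filtration of a quadratic Eisenstein extension**: with `b + 1 = v_𝔓(2θ + c₁)`
(`b ≥ 0` finite), `G_i = Gal(L/K)` for `i ≤ b` and `G_i = 1` for `i > b` — a single break at
`b`, in both numberings (`upperRamificationSubgroup_eq_bot_iff_of_break`).  For `L = K(√π)`
this is `b = 2v_K(2)`, for `K(√(1 + 4u/π^{2k}))`-type units smaller breaks; over `ℚ₂`:
`b = 2` for `ℚ₂(√d)`, `2 ∥ d`, and `b = 1` for `d ≡ 3 (mod 4)`.  Serre, *Local Fields*,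
Ch. IV §1. [cite: SerreLocalFields1979, Ch. IV §1 Prop. 2 ff.] -/
theorem ramificationSubgroup_eq_top_iff_of_quadratic
    [Algebra.IsSeparable (R ⧸ 𝔓.under R) (integralClosure R L ⧸ 𝔓)]
    (h𝔓 : 𝔓 ≠ ⊥) (hG : Nat.card (L ≃ₐ[K] L) = 2) {θ : integralClosure R L} {c₁ c₀ : R}
    (hθ : θ ^ 2 + algebraMap R _ c₁ * θ + algebraMap R _ c₀ = 0)
    (hc₁ : c₁ ∈ 𝔓.under R) (hc₀ : c₀ ∈ 𝔓.under R) (hc₀' : c₀ ∉ (𝔓.under R) ^ 2)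
    {σ : L ≃ₐ[K] L} (hσ : σ • θ ≠ θ) {b : ℕ}
    (hb : ord 𝔓 (2 * θ + algebraMap R _ c₁) = (b + 1 : ℕ)) (i : ℕ) :
    (𝔓.ramificationSubgroup (L ≃ₐ[K] L) i = ⊤ ↔ i ≤ b) ∧
      (𝔓.ramificationSubgroup (L ≃ₐ[K] L) i = ⊥ ↔ b < i) := by
  haveI : IsDedekindDomain (integralClosure R L) := integralClosure.isDedekindDomain R K L
  have key : σ ∈ 𝔓.ramificationSubgroup (L ≃ₐ[K] L) i ↔ i ≤ b := by
    rw [mem_ramificationSubgroup_iff_of_quadratic (K := K) 𝔓 h𝔓 hG hθ hc₁ hc₀ hc₀' hσ i,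
      mem_pow_iff_le_ord, hb, Nat.cast_le]
    omega
  -- `Gal(L/K) = {1, σ}`
  have hσ1 : σ ≠ 1 := by rintro rfl; exact hσ (one_smul _ θ)
  haveI : Finite (L ≃ₐ[K] L) := Nat.finite_of_card_ne_zero (by rw [hG]; norm_num)
  have hall : ∀ g : L ≃ₐ[K] L, g = 1 ∨ g = σ := by
    intro g
    by_contra h
    push Not at h
    have h3 : 3 ≤ Nat.card (L ≃ₐ[K] L) := by
      classical
      haveI := Fintype.ofFinite (L ≃ₐ[K] L)
      rw [Nat.card_eq_fintype_card]
      have : ({1, σ, g} : Finset (L ≃ₐ[K] L)).card = 3 := by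
        rw [Finset.card_insert_of_notMem (by simp [hσ1.symm, h.1.symm]),
          Finset.card_insert_of_notMem (by simp [h.2.symm]), Finset.card_singleton]
      rw [← this]
      exact Finset.card_le_univ _
    omega
  constructor
  · constructor
    · intro h; exact key.mp (by rw [h]; exact Subgroup.mem_top σ)
    · intro h
      rw [eq_top_iff]
      intro g _
      rcases hall g with rfl | rfl
      · exact one_mem _
      · exact key.mpr h
  · constructor
    · intro h
      by_contra hle
      push Not at hle
      have := key.mpr hle
      rw [h] at this
      exact hσ1 (Subgroup.mem_bot.mp this)
    · intro h
      rw [eq_bot_iff]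
      intro g hg
      rcases hall g with rfl | rfl
      · exact Subgroup.mem_bot.mpr rfl
      · exact absurd (key.mp hg) (by omega)

include K in
/-- **`v_𝔓(2θ + c₁) = min (2v_𝔭(2) + 1, 2v_𝔭(c₁))`** for a quadratic Eisenstein extension
(`e = 2`, `v_𝔓(θ) = 1`): `v_𝔓(2θ) = 2v_𝔭(2) + 1` is odd and `v_𝔓(c₁) = 2v_𝔭(c₁)` is even (or
infinite), so the smaller one is the order of the sum.  Serre, *Local Fields*, Ch. IV §1.
[cite: SerreLocalFields1979, Ch. IV §1] -/
theorem ord_two_mul_root_add_eq [Algebra.IsSeparable (R ⧸ 𝔓.under R) (integralClosure R L ⧸ 𝔓)]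
    (h𝔓 : 𝔓 ≠ ⊥) (hG : Nat.card (L ≃ₐ[K] L) = 2) {θ : integralClosure R L} {c₁ c₀ : R}
    (hθ : θ ^ 2 + algebraMap R _ c₁ * θ + algebraMap R _ c₀ = 0)
    (hc₁ : c₁ ∈ 𝔓.under R) (hc₀ : c₀ ∈ 𝔓.under R) (hc₀' : c₀ ∉ (𝔓.under R) ^ 2) :
    ord 𝔓 (2 * θ + algebraMap R _ c₁) =
      min (2 * ord (𝔓.under R) (2 : R) + 1) (2 * ord (𝔓.under R) c₁) := by
  haveI : IsDedekindDomain (integralClosure R L) := integralClosure.isDedekindDomain R K L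
  obtain ⟨he, -, -, hord⟩ := card_inertia_eq_two (K := K) 𝔓 h𝔓 hG hθ hc₁ hc₀ hc₀'
  have h2θ : ord 𝔓 (2 * θ) = 2 * ord (𝔓.under R) (2 : R) + 1 := by
    rw [ord_mul 𝔓 h𝔓, hord, show (2 : integralClosure R L) = algebraMap R _ 2 from (map_ofNat _ 2).symm,
      ord_algebraMap (K := K) 𝔓 h𝔓, he]; norm_cast
  have hC₁ : ord 𝔓 (algebraMap R _ c₁) = 2 * ord (𝔓.under R) c₁ := by
    rw [ord_algebraMap (K := K) 𝔓 h𝔓, he]; norm_cast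
  set C₁ := algebraMap R (integralClosure R L) c₁ with hC₁def
  by_cases htop₂ : ord 𝔓 (2 * θ) = ⊤
  · -- `2θ = 0`
    have h0 : (2 : integralClosure R L) * θ = 0 := by
      by_contra hne; exact ord_ne_top 𝔓 h𝔓 hne htop₂
    rw [h0, zero_add, ← hC₁, ← h2θ, htop₂, min_eq_right le_top]
  by_cases htop₁ : ord 𝔓 C₁ = ⊤
  · -- `c₁ = 0`
    have h0 : C₁ = 0 := by
      by_contra hne; exact ord_ne_top 𝔓 h𝔓 hne htop₁
    rw [h0, add_zero, ← hC₁, ← h2θ, htop₁, min_eq_left le_top]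
  -- both finite: `2a + 1 ≠ 2c`
  obtain ⟨n, hn⟩ := ENat.ne_top_iff_exists.mp htop₂
  obtain ⟨k, hk⟩ := ENat.ne_top_iff_exists.mp htop₁
  obtain ⟨a, ha⟩ : ∃ a : ℕ, ord (𝔓.under R) (2 : R) = a := by
    refine ENat.ne_top_iff_exists.mp (fun h => ?_) |>.imp fun _ h => h.symm
    rw [h] at h2θ; simp at h2θ; exact htop₂ h2θ
  obtain ⟨c, hc⟩ : ∃ c : ℕ, ord (𝔓.under R) c₁ = c := by
    refine ENat.ne_top_iff_exists.mp (fun h => ?_) |>.imp fun _ h => h.symm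
    rw [h] at hC₁; simp at hC₁; exact htop₁ hC₁
  rw [ha] at h2θ
  rw [hc] at hC₁
  have e1 : ord 𝔓 (2 * θ) = (2 * a + 1 : ℕ) := by rw [h2θ]; norm_cast
  have e2 : ord 𝔓 C₁ = (2 * c : ℕ) := by rw [hC₁]; norm_cast
  have hne : 2 * a + 1 ≠ 2 * c := by omega
  rcases Nat.lt_or_gt_of_ne hne with hlt | hgt
  · have hlt' : ord 𝔓 (2 * θ) < ord 𝔓 C₁ := by rw [e1, e2]; exact_mod_cast hlt
    rw [add_comm, ord_add_eq_of_lt 𝔓 hlt', ha, hc, ← h2θ, ← hC₁]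
    exact (min_eq_left hlt'.le).symm
  · have hgt' : ord 𝔓 C₁ < ord 𝔓 (2 * θ) := by rw [e1, e2]; exact_mod_cast hgt
    rw [ord_add_eq_of_lt 𝔓 hgt', ha, hc, ← h2θ, ← hC₁]
    exact (min_eq_right hgt'.le).symm

end Quadratic

end Literature.NumberTheory.GaloisRepresentations

end
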